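import Summits.Ventures.WeilGRH.KeySectionPrinciple
import Summits.Ventures.WeilGRH.KeySectionToTest
import HarnessLib

/-!
# C-VII packaged, convex regime: ONE anti-aligned section bounds the margin of every key of norm `≤ 1`

Cell `rh-explicit`, WEIL TRACK — GRH ARM (weil-grh-5; `GRH-LIT-AS-PRINTED.md` A30/A33).  The CONVEX regime of
the GRH-edge maximum principle (STRUCTURE.md C-VII; weil-grh-4 G33 «single-state» certificates, e.g. parity
`a = 1` at `(log 3)/2`, where only `n = 2` is visible and `(−3/2) = −1`): a real trigonometric section
`u = Σ x_n χ_n` on `[-b, b]` whose spikes `α_n(u) = (u ⋆ ũ)(log n)` are ANTI-ALIGNED with a datum `v⋆` of modulus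
one at every visible prime power (`Re(v⋆(n) α_n(u)) = −|α_n(u)|`), together with a certified Rayleigh bound
`keyMarkovForm a L v⋆ b u ≤ B Σ|x_n|²`, bounds the section form of EVERY datum `v` with `‖v(n)‖ ≤ 1`
(`section_re_sum_le_of_antialigned_chi`, KeySectionPrinciple).  Composed with the section → test transfer
(`keyMargin_le_of_isWindowFunction`, KeySectionToTest):

* `keyMargin_le_of_section_antialigned` — for every `v` with `‖v n‖ ≤ 1` and every window `t_{N'} > b`: any `c`
  with `c‖h‖₂² ≤ E_{a,L,v,N'}(h)` for all test functions `h` on `[−t_{N'}, t_{N'}]` satisfies `c ≤ B`;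
* `charMargin_le_of_section_antialigned` — for EVERY Dirichlet character `χ` mod `q ≠ 1` of parity `a`
  (`|χ(n)| ≤ 1` is automatic): `c‖h‖₂² ≤ Re Q_χ(h)` on the window forces `c ≤ B + (log q − L)`.

Companions: `KeySectionTorusMargin.lean` (torus regime below the entry of `5`), `KeySectionCoverMargin.lean`
(arithmetic regime, finite covers).  Everything is proved; no definitions, no named facts, RH/GRH-free; no
instance data here.  [cite: Weil1952FormulesExplicites, (11) pp. 261–262; Bombieri2000Weil, Thm 2 p. 193;
Yoshida1992, §5 (5.13)–(5.16)]
-/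

set_option autoImplicit false

noncomputable section

open Complex Filter Set MeasureTheory
open scoped Real Topology ComplexConjugate ArithmeticFunction.vonMangoldt

namespace Summit.Ventures.WeilGRH

open Literature.NumberTheory.LFunctions
open Literature.NumberTheory.LFunctions.Yoshida1992 (modes chi chiCore mem_modes)
open Summit.RiemannHypothesis.RiemannHypothesis.Theorems.WeilFormatC

variable {b : ℝ} {q : ℕ}

/-- **Anti-aligned single state ⇒ margins (key form).**  `0 < b < t_{N'} = log(N'+1)/2`; a trigonometric section
`u = Σ_{n∈s} x_n χ_n` on `[-b, b]`, `x ≠ 0`, anti-aligned with `v⋆` at every visible prime power, with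
`keyMarkovForm a L v⋆ b u ≤ B Σ|x_n|²`.  Then for EVERY datum `v` with `‖v n‖ ≤ 1`: any `c` with
`c‖h‖₂² ≤ E_{a,L,v,N'}(h)` for all test functions `h` on `[−t_{N'}, t_{N'}]` satisfies `c ≤ B`. [folklore] -/
theorem keyMargin_le_of_section_antialigned (hb : 0 < b) (s : Finset ℤ) (x : ℤ → ℂ)
    (hx0 : 0 < ∑ n ∈ s, ‖x n‖ ^ 2) {a : ℕ} (ha : a ≤ 1) (L : ℝ) {v vstar : ℕ → ℂ} (hv : ∀ n, ‖v n‖ ≤ 1)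
    (hstar : ∀ n ∈ weilPrimeIndex b, Λ n ≠ 0 →
      (vstar n * weilConv (∑ m ∈ s, x m • chi b m) (weilReflect (∑ m ∈ s, x m • chi b m)) (Real.log n)).re =
        -‖weilConv (∑ m ∈ s, x m • chi b m) (weilReflect (∑ m ∈ s, x m • chi b m)) (Real.log n)‖)
    {B : ℝ} (hB : keyMarkovForm a L vstar b (∑ m ∈ s, x m • chi b m) ≤ B * ∑ n ∈ s, ‖x n‖ ^ 2)
    {N' : ℕ} (hbN : b < Real.log ((N' : ℝ) + 1) / 2) {c : ℝ}
    (hc : ∀ h : ℝ → ℂ, IsWeilTest h →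
      tsupport h ⊆ Icc (-(Real.log ((N' : ℝ) + 1) / 2)) (Real.log ((N' : ℝ) + 1) / 2) →
      c * weilNorm2Sq h ≤ weilFinitePrimeQuadraticKey a L v N' h) :
    c ≤ B := by
  have hsec := section_re_sum_le_of_antialigned_chi hb s x a L hv hstar hB
  set u : ℝ → ℂ := ∑ m ∈ s, x m • chi b m with hu_def
  have hu : IsWindowFunction b u := IsWindowFunction.sum s x fun n _ ↦ isWindowFunction_chi hb n
  have hnorm : ∫ y, ‖u y‖ ^ 2 = ∑ n ∈ s, ‖x n‖ ^ 2 := integral_norm_sq_sum_smul_chi hb s x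
  have hBv : keyMarkovForm a L v b u ≤ B * ∫ y, ‖u y‖ ^ 2 := by
    rw [hnorm, hu_def, keyMarkovForm_sum_smul_chi hb s x a L v]
    exact hsec
  have hu0 : 0 < ∫ y, ‖u y‖ ^ 2 := by rwa [hnorm]
  have hBv' : keyMarkovForm a L v (Real.log ((N' : ℝ) + 1) / 2) u ≤ B * ∫ y, ‖u y‖ ^ 2 := by
    rwa [keyMarkovForm_window_eq_of_isWindowFunction hu hbN.le]
  exact keyMargin_le_of_isWindowFunction hb.le hu hbN ha L v hu0 hBv' hc

/-- **Anti-aligned single state ⇒ margins (character form).**  Same section data.  For EVERY Dirichlet character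
`χ` mod `q ≠ 1` of parity `a`: if `c‖h‖₂² ≤ Re Q_χ(h)` for every test function `h` on `[−t_{N'}, t_{N'}]`
(`b < t_{N'}`), then `c ≤ B + (log q − L)` («margin(χ) ≤ B + log(q/q₀)» at `L = log q₀`). [folklore] -/
theorem charMargin_le_of_section_antialigned (hb : 0 < b) (s : Finset ℤ) (x : ℤ → ℂ)
    (hx0 : 0 < ∑ n ∈ s, ‖x n‖ ^ 2) {a : ℕ} (ha : a ≤ 1) (L : ℝ) {vstar : ℕ → ℂ}
    (hstar : ∀ n ∈ weilPrimeIndex b, Λ n ≠ 0 →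
      (vstar n * weilConv (∑ m ∈ s, x m • chi b m) (weilReflect (∑ m ∈ s, x m • chi b m)) (Real.log n)).re =
        -‖weilConv (∑ m ∈ s, x m • chi b m) (weilReflect (∑ m ∈ s, x m • chi b m)) (Real.log n)‖)
    {B : ℝ} (hB : keyMarkovForm a L vstar b (∑ m ∈ s, x m • chi b m) ≤ B * ∑ n ∈ s, ‖x n‖ ^ 2)
    {N' : ℕ} (hbN : b < Real.log ((N' : ℝ) + 1) / 2)
    (hq : q ≠ 1) (χ : DirichletCharacter ℂ q) (hχa : charParity χ = a) {c : ℝ}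
    (hc : ∀ h : ℝ → ℂ, IsWeilTest h →
      tsupport h ⊆ Icc (-(Real.log ((N' : ℝ) + 1) / 2)) (Real.log ((N' : ℝ) + 1) / 2) →
      c * weilNorm2Sq h ≤ (weilQuadraticChar χ h).re) :
    c ≤ B + (Real.log q - L) := by
  have hv : ∀ n : ℕ, ‖χ (n : ZMod q)‖ ≤ 1 := fun n ↦ DirichletCharacter.norm_le_one χ _
  have hN : Real.exp (2 * (Real.log ((N' : ℝ) + 1) / 2)) ≤ (N' : ℝ) + 1 := by
    rw [mul_div_cancel₀ _ two_ne_zero, Real.exp_log (by positivity)]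
  have hc' : ∀ h : ℝ → ℂ, IsWeilTest h →
      tsupport h ⊆ Icc (-(Real.log ((N' : ℝ) + 1) / 2)) (Real.log ((N' : ℝ) + 1) / 2) →
      (c - (Real.log q - L)) * weilNorm2Sq h ≤
        weilFinitePrimeQuadraticKey a L (fun n ↦ χ (n : ZMod q)) N' h := by
    intro h hh hs
    have h1 := hc h hh hs
    rw [re_weilQuadraticChar_eq_keyMarkovForm hq χ hh hs, hχa,
      keyMarkovForm_eq_weilFinitePrimeQuadraticKey hh hs hN ha (Real.log q) (fun n ↦ χ (n : ZMod q)),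
      weilFinitePrimeQuadraticKey_eq_add_norm hh a L (Real.log q) _ N'] at h1
    rw [sub_mul]
    linarith
  have key := keyMargin_le_of_section_antialigned hb s x hx0 ha L hv hstar hB hbN hc'
  linarith

end Summit.Ventures.WeilGRH

end
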